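import Mathlib
import HarnessLib
import Summits.HubbardSuperconductivity.HubbardSuperconductivity.Theorems.KLProgrammeKLRegimeEngineScaleZeroKernelNormsWt
import Summits.HubbardSuperconductivity.HubbardSuperconductivity.Theorems.KLProgrammeKLRegimeEngineKernelNormsWt4

/-!
# Route `KLProgramme` — crux K3 ENGINE (stmt-HubbardSuperconductivity-20437 `KLRegimeEngineV17F2`), stub (b): the blocked-tower bookkeeping,
# part 15 — PARITY at every scale (odd degrees carry nothing) and the LAW-UNITS fit into `klWtBudget` (E1 lead r2d-p2 g8)

Two pieces of glue every model-side instantiation of the tower needs and nobody should re-derive: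

* §1 PARITY.  `klEffectiveAction_eq_effAction_map` — at EVERY scale `j` and every cutoff unit `e₀`, the scale-`j` action at the frame `K` IS one Gaussian step of
  the substituted grid vertex: `𝒱_j[K] = effAction C^K_{>Λ_j} (map S (V_N + 𝒩_{K,N}))` (the cumulative definition, `N = 4M`; the scale-`0` case is p3's
  `klEffectiveAction_zero_eq_effAction_map`); hence `klEffectiveAction_mem_evenPart` (the action is EVEN at every scale, no partition-function hypothesis),
  `map_sectorAnalysis_klEffectiveAction_mem_evenPart` (so is its analysis in ANY family), **`klWtPinnedSum_eq_zero_of_odd`** (odd degrees carry nothing at every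
  scale) and **`kernelNormsWt4_of_even`** — `KernelNormsWt4 N … K j` follows from the bounds in the EVEN degrees `2p ≠ 2` alone once `0 ≤ N m` at odd `m`
  (so the tower, which lives in even degrees, closes conjunct 2's weighted clause without an odd-degree case).
* §2 UNITS.  The tower's born/measured profiles are in LAW UNITS: degree `2p` at level `j` carries `2^{(3p−5)j}`, the dimensionless profile is `A·λ^{p−1}·Q^p` with
  `λ = Bλ·ε_j` (E1-TOWER-BLOCKED §4/§9; `klWtBudget_two_mul_of_two_le`).  **`law_mul_units_le_klWtBudget`** — if `A·Q ≤ CE` and `Bλ·Q ≤ CE` then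
  `A·(Bλ·ε_j)^{p−1}·Q^p·2^{(3p−5)j} ≤ klWtBudget P Qc U j (2p)` for every `p ≥ 2` with `Qc.CE = CE`… stated for an arbitrary package `Qc` with `CE ≤ Qc.CE`;
  `law_mul_units_le_levels` — the same with the levels gain `(2^{−j})^{e}` on both sides.  Pure real arithmetic: the two constants `A·Q` and `Bλ·Q` are what the
  public constant `CE_pub` must dominate (memo §4: `CE ≥ B·Q·c₂·E·8^d…`).

Nothing about the model's sizes is asserted; nothing asserts superconductivity.
References: BGM 2006 §2.3 (2.17)–(2.23), §2.8 (2.83) [cite: BenfattoGiulianiMastropietro2006].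
-/

noncomputable section

namespace Summit.HubbardSuperconductivity.HubbardSuperconductivity.Theorems.EngineV8

set_option linter.dupNamespace false -- summit = problem name (single-conjunct summit), D-0017

open Real Finset Literature.MathematicalPhysics.QuantumLattice Literature.Probability.LatticeModels
open Literature.MathematicalPhysics.QuantumLattice.GrassmannAlgebra
open Summit.HubbardSuperconductivity.HubbardSuperconductivity.Theorems.KLRegimeSplit
open Summit.HubbardSuperconductivity.HubbardSuperconductivity.Theorems.KLProgrammeLegKernels

variable {L M : ℕ} [NeZero L]

/-! ## §1 Parity at every scale -/

/-- **`𝒱_j[K] = effAction C^K_{>Λ_j} (map S (V_N + 𝒩_{K,N}))` at EVERY scale `j` and cutoff unit `e₀`** (`β ≠ 0`, `N = 4M`): the scale-`j` action of the KL programme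
at the frame `K` is one Gaussian step, with the infrared-cut covariance above `Λ_j = klScale e₀ j`, of the grid vertex pushed forward by the grid substitution
(the `j = 0` case is `klEffectiveAction_zero_eq_effAction_map`). -/
theorem klEffectiveAction_eq_effAction_map [NeZero M] {β : ℝ} (hβ : β ≠ 0) (U μ : ℝ) (K : TrigPolyC4v) (e₀ : ℝ) (j : ℕ) :
    klEffectiveAction L M β U μ K e₀ j =
      effAction ℂ (hubbardCovAboveCT L M β μ 0 K (klScale e₀ j))
        (ExteriorAlgebra.map (Matrix.toLin' (hubbardGridSub L M β (2 * (2 * M))))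
          (hubbardGridInteraction L (2 * (2 * M)) β U + hubbardGridCounterQuadratic L (2 * (2 * M)) β K)) := by
  haveI : NeZero (2 * (2 * M)) := ⟨by have := NeZero.ne M; omega⟩
  rw [klEffectiveAction, hubbardEffectiveActionCT, hubbardInteractionCT, map_add,
    map_hubbardGridSub_gridInteraction hβ U (by omega), map_hubbardGridSub_gridCounterQuadratic hβ K (by omega)]

/-- **The scale-`j` action is EVEN**, at every scale, frame and cutoff unit (`β ≠ 0`): a Gaussian step of an even, constant-free input. -/
theorem klEffectiveAction_mem_evenPart [NeZero M] {β : ℝ} (hβ : β ≠ 0) (U μ : ℝ) (K : TrigPolyC4v) (e₀ : ℝ) (j : ℕ) :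
    klEffectiveAction L M β U μ K e₀ j ∈ evenPart ℂ (HubbardFieldIdx L M) := by
  haveI : NeZero (2 * (2 * M)) := ⟨by have := NeZero.ne M; omega⟩
  rw [klEffectiveAction_eq_effAction_map hβ U μ K e₀ j]
  set Vt := hubbardGridInteraction L (2 * (2 * M)) β U + hubbardGridCounterQuadratic L (2 * (2 * M)) β K with hVt
  have hVt_even : Vt ∈ evenPart ℂ (GridLeg (GridPoint L (2 * (2 * M)))) :=
    add_mem (hubbardGridInteraction_mem_evenPart β U) (hubbardGridCounterQuadratic_mem_evenPart β K)
  have hVt0 : constPart ℂ Vt = 0 := by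
    rw [hVt, map_add, constPart_hubbardGridInteraction, constPart_hubbardGridCounterQuadratic, add_zero]
  have hSV : ExteriorAlgebra.map (Matrix.toLin' (hubbardGridSub L M β (2 * (2 * M)))) Vt ∈ evenPart ℂ (HubbardFieldIdx L M) :=
    mem_evenPart_iff.2 (map_mem_evenOdd_zero ℂ _ (mem_evenPart_iff.1 hVt_even))
  have hSV0 : constPart ℂ (ExteriorAlgebra.map (Matrix.toLin' (hubbardGridSub L M β (2 * (2 * M)))) Vt) = 0 := by
    rw [constPart_map, hVt0]
  exact effAction_mem_evenPart _ hSV hSV0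

/-- **The analysed scale-`j` action is even in ANY family** (family index `n`, e.g. a finer level of the one-shot tower): `map (toLin' E_n) 𝒱_j[K] ∈ evenPart`. -/
theorem map_sectorAnalysis_klEffectiveAction_mem_evenPart [NeZero M] {β : ℝ} (hβ : β ≠ 0) (U μ : ℝ) (K : TrigPolyC4v) (e₀ : ℝ) (n j : ℕ) :
    ExteriorAlgebra.map (Matrix.toLin' (sectorAnalysisMatrix L M β (klAnisoFamily L M β μ K e₀ n)))
        (klEffectiveAction L M β U μ K e₀ j) ∈ evenPart ℂ (SpaceTimeIdx L M × SectorLeg (sectorCount n)) :=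
  mem_evenPart_iff.2 (map_mem_evenOdd_zero ℂ _ (mem_evenPart_iff.1 (klEffectiveAction_mem_evenPart hβ U μ K e₀ j)))

/-- Differences of scale actions (the tower's INCREMENTS) are even, analysed in any family. -/
theorem map_sectorAnalysis_klEffectiveAction_sub_mem_evenPart [NeZero M] {β : ℝ} (hβ : β ≠ 0) (U μ : ℝ) (K : TrigPolyC4v) (e₀ : ℝ) (n j j' : ℕ) :
    ExteriorAlgebra.map (Matrix.toLin' (sectorAnalysisMatrix L M β (klAnisoFamily L M β μ K e₀ n)))
        (klEffectiveAction L M β U μ K e₀ j - klEffectiveAction L M β U μ K e₀ j') ∈ evenPart ℂ (SpaceTimeIdx L M × SectorLeg (sectorCount n)) := by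
  rw [map_sub]
  exact sub_mem (map_sectorAnalysis_klEffectiveAction_mem_evenPart hβ U μ K e₀ n j) (map_sectorAnalysis_klEffectiveAction_mem_evenPart hβ U μ K e₀ n j')

/-- **Odd degrees carry nothing, at every scale**: `klWtPinnedSum … K j m q w = 0` for odd `m` (`β ≠ 0`). -/
theorem klWtPinnedSum_eq_zero_of_odd [NeZero M] {β : ℝ} (hβ : β ≠ 0) (U μ : ℝ) (K : TrigPolyC4v) (j : ℕ) {m : ℕ} (hm : Odd m)
    (q : Fin m) (w : SpaceTimeIdx L M × SectorLeg (sectorCount j)) : klWtPinnedSum L M β U μ K j m q w = 0 := by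
  rw [klWtPinnedSum_def]
  refine mul_eq_zero_of_right _ (sum_eq_zero fun X _ => ?_)
  rw [kernel_eq_zero_of_mem_evenPart_of_odd ℂ (map_sectorAnalysis_klEffectiveAction_mem_evenPart hβ U μ K klE0 j j) hm X, norm_zero, mul_zero]

/-- **`KernelNormsWt4` from the EVEN degrees alone**: if `klWtPinnedSum … K j m q w ≤ N m` for every EVEN `m ≠ 2` and `0 ≤ N m` at every odd `m`,
then `KernelNormsWt4 L M N β U μ K j` (`β ≠ 0`; the tower lives in even degrees). -/
theorem kernelNormsWt4_of_even [NeZero M] {β : ℝ} (hβ : β ≠ 0) {U μ : ℝ} {K : TrigPolyC4v} {j : ℕ} {N : ℕ → ℝ}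
    (hodd : ∀ m : ℕ, Odd m → 0 ≤ N m)
    (heven : ∀ m : ℕ, Even m → m ≠ 2 → ∀ (q : Fin m) (w : SpaceTimeIdx L M × SectorLeg (sectorCount j)), klWtPinnedSum L M β U μ K j m q w ≤ N m) :
    KernelNormsWt4 L M N β U μ K j := by
  intro m hm q w
  rcases Nat.even_or_odd m with he | ho
  · exact heven m he hm q w
  · rw [klWtPinnedSum_eq_zero_of_odd hβ U μ K j ho q w]
    exact hodd m ho

/-! ## §2 Law units: the dimensionless profile fits the E1 budget -/

/-- **The law in units fits under `CE^p ε^{p−1}`**: `0 ≤ A, Q, Bλ, ε`, `A·Q ≤ CE`, `Bλ·Q ≤ CE`, `1 ≤ p` ⇒ `A·(Bλ·ε)^{p−1}·Q^p ≤ CE^p·ε^{p−1}`. -/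
theorem law_le_pow_mul_pow {A Q Bl ε CE : ℝ} (hA : 0 ≤ A) (hQ : 0 ≤ Q) (hBl : 0 ≤ Bl) (hε : 0 ≤ ε) (hAQ : A * Q ≤ CE) (hBQ : Bl * Q ≤ CE)
    {p : ℕ} (hp : 1 ≤ p) : A * (Bl * ε) ^ (p - 1) * Q ^ p ≤ CE ^ p * ε ^ (p - 1) := by
  have hCE : 0 ≤ CE := (mul_nonneg hA hQ).trans hAQ
  obtain ⟨r, rfl⟩ : ∃ r, p = r + 1 := ⟨p - 1, by omega⟩
  simp only [Nat.add_sub_cancel]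
  calc A * (Bl * ε) ^ r * Q ^ (r + 1) = (A * Q) * (Bl * Q) ^ r * ε ^ r := by ring
    _ ≤ CE * CE ^ r * ε ^ r := by gcongr
    _ = CE ^ (r + 1) * ε ^ r := by ring

/-- **THE FIT INTO `klWtBudget`**: for a package `Qc` with `CE ≤ Qc.CE` (`0 ≤ CE`), `0 ≤ P.Klam`, constants `A·Q ≤ CE`, `Bλ·Q ≤ CE` and every `p ≥ 2`, the dimensional size
`A·(Bλ·ε_j)^{p−1}·Q^p · 2^{(3p−5)j}` (dimensionless law × units, `ε_j = epsCoupling P U j`) is at most `klWtBudget P Qc U j (2p)`. -/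
theorem law_mul_units_le_klWtBudget {P : SplitConsts} {Qc : EngConsts} {A Q Bl CE : ℝ} (hK : 0 ≤ P.Klam) (hA : 0 ≤ A) (hQ : 0 ≤ Q) (hBl : 0 ≤ Bl)
    (hAQ : A * Q ≤ CE) (hBQ : Bl * Q ≤ CE) (hCE : CE ≤ Qc.CE) (U : ℝ) (j : ℕ) {p : ℕ} (hp : 2 ≤ p) :
    A * (Bl * epsCoupling P U j) ^ (p - 1) * Q ^ p * (2 : ℝ) ^ ((3 * (p : ℤ) - 5) * j) ≤ klWtBudget P Qc U j (2 * p) := by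
  have hε : 0 ≤ epsCoupling P U j := epsCoupling_nonneg' hK U j
  have hCE0 : 0 ≤ CE := (mul_nonneg hA hQ).trans hAQ
  rw [klWtBudget_two_mul_of_two_le P Qc U j hp]
  refine mul_le_mul_of_nonneg_right ?_ (by positivity)
  calc A * (Bl * epsCoupling P U j) ^ (p - 1) * Q ^ p ≤ CE ^ p * epsCoupling P U j ^ (p - 1) :=
        law_le_pow_mul_pow hA hQ hBl hε hAQ hBQ (by omega)
    _ ≤ Qc.CE ^ p * epsCoupling P U j ^ (p - 1) := by gcongr

/-- **The same fit with the LEVELS gain** `(2^{−j})^{e}` riding on both sides (the levels track's units): for `p ≥ 2`,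
`A·(Bλ·ε_j)^{p−1}·Q^p·2^{(3p−5)j}·(2^j)^{−e}… ≤ Qc.CE^p·ε_j^{p−1}·2^{(3p−5)j}·((2^j)⁻¹)^e`. -/
theorem law_mul_units_le_levels {P : SplitConsts} {Qc : EngConsts} {A Q Bl CE : ℝ} (hK : 0 ≤ P.Klam) (hA : 0 ≤ A) (hQ : 0 ≤ Q) (hBl : 0 ≤ Bl)
    (hAQ : A * Q ≤ CE) (hBQ : Bl * Q ≤ CE) (hCE : CE ≤ Qc.CE) (U : ℝ) (j e : ℕ) {p : ℕ} (hp : 2 ≤ p) :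
    A * (Bl * epsCoupling P U j) ^ (p - 1) * Q ^ p * (2 : ℝ) ^ ((3 * (p : ℤ) - 5) * j) * (((2 : ℝ) ^ j)⁻¹) ^ e ≤
      Qc.CE ^ p * epsCoupling P U j ^ (p - 1) * (2 : ℝ) ^ ((3 * (p : ℤ) - 5) * j) * (((2 : ℝ) ^ j)⁻¹) ^ e := by
  have h := law_mul_units_le_klWtBudget hK hA hQ hBl hAQ hBQ hCE U j hp (Qc := Qc)
  rw [klWtBudget_two_mul_of_two_le P Qc U j hp] at h
  exact mul_le_mul_of_nonneg_right h (by positivity)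

end Summit.HubbardSuperconductivity.HubbardSuperconductivity.Theorems.EngineV8

end
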